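import Mathlib.RingTheory.Kaehler.Basic
import Mathlib.RingTheory.Conductor
import HarnessLib

/-!
# The conductor of a subring annihilates the relative Kähler differentials

Topic `RingTheory/Derivation`; namespace `Literature.RingTheory.Derivation`. THEOREMS ONLY (Mathlib-only imports;
no definition, no named fact, no instance, no `sorry`).

For a commutative ring `S`, a subalgebra `C ⊆ S` (over any base `R`) and `c ∈ S` with `c · S ⊆ C` (an element of the
CONDUCTOR of `C` in `S`), `c` kills `Ω_C(S)`: `c · ω = 0` for every `ω ∈ Ω[S⁄C]` — since `c · db = d(cb) − b · dc`
with `cb, c ∈ C`. In particular Mathlib's `conductor R x` (the conductor of `R⟨x⟩ = Algebra.adjoin R {x}` in `S`)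
annihilates `Ω[S⁄R⟨x⟩]` (`conductor_le_annihilator_kaehlerDifferential_adjoin`). This is the differential form of
Dedekind–Euler's relation `𝔯 · 𝔇_{B/A} = (f'(x))` between the conductor `𝔯` of `A[x]` in `B` and the different
(J.-P. Serre, *Local Fields*, Ch. III §6, Cor. 1 to Prop. 11; Mathlib `conductor_mul_differentIdeal`), read through
§7 Prop. 14 («the annihilator of `Ω_A(B)` is the different»): the cokernel of `Ω_A(B') ← B' ⊗ Ω_A(A[x])`, which is
`Ω_{A[x]}(B')`, is killed by `𝔯`.

Use (tree): the Kähler-differential proof of Tate's almost étale lemma in the cyclotomic tower (crux dir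
`Summits/BirchSwinnertonDyer/…/StarredOptimalManinUnitFiveSeven/Lines/kato-lever-TS1-omega-route.md`, step «coker γ is
killed by the conductor»).

## References
* J.-P. Serre, *Local Fields* (1979), Ch. III §6 Cor. 1–2 of Prop. 11 (conductor and different), §7 Prop. 14.
  [SerreLocalFields1979]
-/

noncomputable section

namespace Literature.RingTheory.Derivation

open KaehlerDifferential

/-- **An element conducting `S` into a subalgebra `C` kills `Ω_C(S)`**: if `c · b ∈ C` for all `b ∈ S` then
`c · ω = 0` for every `ω ∈ Ω[S⁄C]` (`c · db = d(cb) − b · dc`, and `d` vanishes on `C`).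
[cite: SerreLocalFields1979, Ch. III §6 Cor. 1 of Prop. 11 (the conductor) with §7 Prop. 14 (annihilator of Ω)] -/
theorem smul_kaehlerDifferential_eq_zero_of_forall_mul_mem {R S : Type*} [CommRing R] [CommRing S] [Algebra R S]
    (C : Subalgebra R S) {c : S} (hc : ∀ b : S, c * b ∈ C) (ω : Ω[S⁄C]) : c • ω = 0 := by
  have hω : ω ∈ Submodule.span S (Set.range (D C S)) := by
    rw [KaehlerDifferential.span_range_derivation]; exact Submodule.mem_top
  have hcC : c ∈ C := by simpa using hc 1
  induction hω using Submodule.span_induction with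
  | mem w hw =>
    obtain ⟨b, rfl⟩ := hw
    -- `c • db = d(c b) - b • dc`, and both `c b` and `c` come from `C`
    have h1 : D C S (c * b) = c • D C S b + b • D C S c := Derivation.leibniz _ _ _
    have h2 : D C S (c * b) = 0 := by
      have : c * b = algebraMap C S ⟨c * b, hc b⟩ := rfl
      rw [this, Derivation.map_algebraMap]
    have h3 : D C S c = 0 := by
      have : c = algebraMap C S ⟨c, hcC⟩ := rfl
      rw [this, Derivation.map_algebraMap]
    rw [h2, h3, smul_zero, add_zero] at h1
    exact h1.symm
  | zero => exact smul_zero _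
  | add w₁ w₂ _ _ h₁ h₂ => rw [smul_add, h₁, h₂, add_zero]
  | smul a w _ h => rw [smul_comm, h, smul_zero]

/-- **The conductor of `R⟨x⟩` in `S` annihilates `Ω_{R⟨x⟩}(S)`**: Mathlib's `conductor R x` is contained in the
annihilator of the `S`-module `Ω[S⁄Algebra.adjoin R {x}]`.
[cite: SerreLocalFields1979, Ch. III §6 Cor. 1 of Prop. 11 with §7 Prop. 14] -/
theorem conductor_le_annihilator_kaehlerDifferential_adjoin {R S : Type*} [CommRing R] [CommRing S] [Algebra R S]
    (x : S) : conductor R x ≤ (⊤ : Submodule S (Ω[S⁄Algebra.adjoin R ({x} : Set S)])).annihilator := by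
  intro c hc
  rw [Submodule.mem_annihilator]
  intro ω _
  exact smul_kaehlerDifferential_eq_zero_of_forall_mul_mem (Algebra.adjoin R ({x} : Set S))
    (fun b => mem_conductor_iff.1 hc b) ω

end Literature.RingTheory.Derivation

end
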